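import Literature.Probability.RandomPlanarGeometry.HexSAWBrickWallStripCuts
import Literature.Probability.RandomPlanarGeometry.HexSAWBrickWallStripMargin
import HarnessLib

/-!
# From an abstract column insertion to the margin: the summation step of «HEX-STRIP-STRICT»

Topic `Literature/Probability/RandomPlanarGeometry` (continues `HexSAWBrickWallStripCuts.lean` — the parity-admissible
column cuts `HexBW.admissibleCuts T a ω n` of a walk of the honeycomb strip `S_T`, at least `⌊n/(2(T+1))⌋` of them —
and `HexSAWBrickWallStripMargin.lean` — the extraction `HexBW.log_stripConnectiveConstant_succ_sub_log_ge_of_core`: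
the summed finite core `c_n(S_T) xⁿ (1 + x^{4T+8})^{⌊n/(2(T+1))⌋} ≤ Σ_{m ≤ (4T+9)n} c_m(S_{T+1}) x^m` gives the margin
`log(1 + μ(S_{T+1})^{-(4T+8)})/(2(T+1)) ≤ log μ(S_{T+1}) − log μ(S_T)`).  Source: N. Madras, G. Slade, *The
Self-Avoiding Walk* (1993), §8.2, Theorem 8.2.1 (8.2.13) (strict monotonicity in the width, printed without margin;
for honeycomb strips Beaton–Bousquet-Mélou–de Gier–Duminil-Copin–Guttmann 2014, Proposition 7 at `y = 1`); the lane's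
planar proof with margin is `SAWStripInsertionMargin.lean` (column insertion; its summation lemmas `le_sum_dom`,
`sum_dom_le`, `finite_core` are private there and are abstracted here).

## What is proved (lane «pcv-sawmu», door «HEX-STRIP-STRICT» of a-idea-1 g16, ROUTES-G16 §2: the glue between the
## combinatorial faces H1–H3 and the analytic faces H4–H5)

Let an INSERTION for the width `T` be given abstractly: for every length `n`, a map `Ψ n` from pairs
`(p, R)` — `p = (a, ω) ∈ stripPairs T n` a walk of `S_T`, `R ⊆ admissibleCuts T a ω n` a set of admissible cuts —
to pairs, and a cost `cost n p c ∈ ℕ` per cut, such that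
(i) `Ψ n p R ∈ stripPairs (T+1) (n + Σ_{c ∈ R} cost n p c)` (the image is a walk of the wider strip, longer by the
total cost), (ii) `cost n p c ≤ 4T + 8`, (iii) `(p, R) ↦ Ψ n p R` is injective on that domain.  THEN
(`HexBW.core_of_insertion`) the summed finite core holds with `B = 1`, `K = 4T + 9`, hence
(`HexBW.log_stripConnectiveConstant_succ_sub_log_ge_of_insertion`) the margin
`log(1 + μ(S_{T+1})^{-(4T+8)})/(2(T+1)) ≤ log μ(S_{T+1}) − log μ(S_T)` — a-idea-1's face `StripStrictMargin T` — and
the printed strict inequality `μ(S_T) < μ(S_{T+1})` (`HexBW.stripConnectiveConstant_lt_succ_of_insertion`).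
The 4-column insertion of ROUTES-G16 §2.3 (faces H1–H3: construction, membership with cost `≤ 4T+8`, injectivity) is
NOT constructed here; this file fixes its target.

Proof (the tree's X16 summation, abstracted): `Σ_{R ⊆ adm} x^{n + Σ cost} = xⁿ Π_{c ∈ adm} (1 + x^{cost c})
≥ xⁿ (1 + x^{4T+8})^{#adm} ≥ xⁿ (1 + x^{4T+8})^{⌊n/(2(T+1))⌋}` per walk (`x ≤ 1`, `div_le_card_admissibleCuts`); summing
over the walks and regrouping the injective images by their length `m ≤ (4T+9) n` bounds the total by
`Σ_m c_m(S_{T+1}) x^m`.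
-/

noncomputable section

open Finset Literature.Probability.LatticeModels Literature.Probability.Percolation

namespace Literature.Probability.RandomPlanarGeometry.SAW.HexBW

section Core

variable {T : ℕ} (Ψ : ℕ → (Site 2 × (ℕ → Site 2)) → Finset ℤ → (Site 2 × (ℕ → Site 2)))
  (cost : ℕ → (Site 2 × (ℕ → Site 2)) → ℤ → ℕ)

/-- The domain of an insertion at length `n`: pairs (walk of `S_T`, subset of its admissible cuts).
[cite: MadrasSlade1993, §8.2, Theorem 8.2.1 (8.2.13) (column insertion)] -/
def insDom (T n : ℕ) : Finset (Σ _ : Site 2 × (ℕ → Site 2), Finset ℤ) :=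
  (stripPairs T n).sigma fun p => (admissibleCuts T p.1 p.2 n).powerset

/-- The length of the image of a pair: `n` plus the total cost of the chosen cuts.
[cite: MadrasSlade1993, §8.2, Theorem 8.2.1 (8.2.13)] -/
def insLen (n : ℕ) (q : Σ _ : Site 2 × (ℕ → Site 2), Finset ℤ) : ℕ := n + ∑ c ∈ q.2, cost n q.1 c

/-- Membership in `insDom`. [cite: MadrasSlade1993, §8.2, Theorem 8.2.1 (8.2.13)] -/
theorem mem_insDom {n : ℕ} {q : Σ _ : Site 2 × (ℕ → Site 2), Finset ℤ} :
    q ∈ insDom T n ↔ q.1 ∈ stripPairs T n ∧ q.2 ⊆ admissibleCuts T q.1.1 q.1.2 n := by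
  rw [insDom, Finset.mem_sigma, Finset.mem_powerset]

variable {Ψ cost}

/-- The image length is at most `(4T+9) n` when each cut costs at most `4T+8` (there are at most `n` cuts).
[cite: MadrasSlade1993, §8.2, Theorem 8.2.1 (8.2.13)] -/
theorem insLen_le {n : ℕ}
    (hcost : ∀ p, p ∈ stripPairs T n → ∀ c ∈ admissibleCuts T p.1 p.2 n, cost n p c ≤ 4 * T + 8)
    {q : Σ _ : Site 2 × (ℕ → Site 2), Finset ℤ} (hq : q ∈ insDom T n) :
    insLen cost n q ≤ (4 * T + 9) * n := by
  obtain ⟨hp, hR⟩ := mem_insDom.1 hq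
  have h1 : ∑ c ∈ q.2, cost n q.1 c ≤ ∑ _c ∈ q.2, (4 * T + 8) :=
    Finset.sum_le_sum fun c hc => hcost q.1 hp c (hR hc)
  rw [Finset.sum_const, smul_eq_mul] at h1
  have h2 : q.2.card ≤ n :=
    ((Finset.card_le_card hR).trans (Finset.card_filter_le _ _)).trans (card_cuts_le q.1.1 q.1.2 n)
  unfold insLen
  nlinarith

/-- The generating polynomial of the pairs, regrouped by image length. [cite: MadrasSlade1993, §8.2, Theorem 8.2.1 (8.2.13)] -/
theorem sum_insDom_eq {n : ℕ}
    (hcost : ∀ p, p ∈ stripPairs T n → ∀ c ∈ admissibleCuts T p.1 p.2 n, cost n p c ≤ 4 * T + 8) (x : ℝ) :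
    ∑ q ∈ insDom T n, x ^ insLen cost n q =
      ∑ m ∈ Finset.range ((4 * T + 9) * n + 1),
        (((insDom T n).filter fun q => insLen cost n q = m).card : ℝ) * x ^ m := by
  rw [← Finset.sum_fiberwise_of_maps_to (g := insLen cost n) (t := Finset.range ((4 * T + 9) * n + 1))
    fun q hq => Finset.mem_range.2 (Nat.lt_succ_of_le (insLen_le hcost hq))]
  refine Finset.sum_congr rfl fun m _ => ?_
  rw [Finset.sum_congr rfl fun q hq => by rw [(Finset.mem_filter.1 hq).2], Finset.sum_const, nsmul_eq_mul]

/-- **Upper bound**: the pairs of image length `m` inject into the `m`-step walks of `S_{T+1}`.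
[cite: MadrasSlade1993, §8.2, Theorem 8.2.1 (8.2.13)] -/
theorem sum_insDom_le {n : ℕ}
    (hcost : ∀ p, p ∈ stripPairs T n → ∀ c ∈ admissibleCuts T p.1 p.2 n, cost n p c ≤ 4 * T + 8)
    (hmem : ∀ p R, p ∈ stripPairs T n → R ⊆ admissibleCuts T p.1 p.2 n →
      Ψ n p R ∈ stripPairs (T + 1) (n + ∑ c ∈ R, cost n p c))
    (hinj : Set.InjOn (fun q : (Σ _ : Site 2 × (ℕ → Site 2), Finset ℤ) => Ψ n q.1 q.2) ↑(insDom T n))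
    {x : ℝ} (hx : 0 ≤ x) :
    ∑ q ∈ insDom T n, x ^ insLen cost n q ≤
      ∑ m ∈ Finset.range ((4 * T + 9) * n + 1), (stripCount (T + 1) m : ℝ) * x ^ m := by
  rw [sum_insDom_eq hcost]
  refine Finset.sum_le_sum fun m _ => mul_le_mul_of_nonneg_right ?_ (pow_nonneg hx m)
  rw [stripCount]
  exact_mod_cast Finset.card_le_card_of_injOn (fun q : (Σ _ : Site 2 × (ℕ → Site 2), Finset ℤ) => Ψ n q.1 q.2)
    (fun q hq => by
      have hq' := Finset.mem_filter.1 (Finset.mem_coe.1 hq)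
      obtain ⟨hp, hR⟩ := mem_insDom.1 hq'.1
      have h := hmem q.1 q.2 hp hR
      have e : n + ∑ c ∈ q.2, cost n q.1 c = m := hq'.2
      rw [e] at h
      exact Finset.mem_coe.2 h)
    (hinj.mono fun q hq => by
      exact Finset.mem_coe.2 (Finset.mem_filter.1 (Finset.mem_coe.1 hq)).1)

/-- **Lower bound**: `Σ_{R ⊆ adm} x^{len} = xⁿ Π_{c ∈ adm} (1 + x^{cost c}) ≥ xⁿ (1 + x^{4T+8})^{⌊n/(2(T+1))⌋}` for each
walk of `S_T` (`x ≤ 1`, `#adm ≥ ⌊n/(2(T+1))⌋`), summed over the walks. [cite: MadrasSlade1993, §8.2, Theorem 8.2.1 (8.2.13)] -/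
theorem le_sum_insDom {n : ℕ}
    (hcost : ∀ p, p ∈ stripPairs T n → ∀ c ∈ admissibleCuts T p.1 p.2 n, cost n p c ≤ 4 * T + 8)
    {x : ℝ} (hx : 0 ≤ x) (hx1 : x ≤ 1) :
    (stripCount T n : ℝ) * x ^ n * (1 + x ^ (4 * T + 8)) ^ (n / (2 * (T + 1))) ≤
      ∑ q ∈ insDom T n, x ^ insLen cost n q := by
  rw [insDom, Finset.sum_sigma]
  have key : ∀ p ∈ stripPairs T n,
      x ^ n * (1 + x ^ (4 * T + 8)) ^ (n / (2 * (T + 1))) ≤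
        ∑ R ∈ (admissibleCuts T p.1 p.2 n).powerset, x ^ insLen cost n ⟨p, R⟩ := by
    intro p hp
    have hp' : (p.1, p.2) ∈ stripPairs T n := hp
    show _ ≤ ∑ R ∈ (admissibleCuts T p.1 p.2 n).powerset, x ^ (n + ∑ c ∈ R, cost n p c)
    rw [Finset.sum_congr rfl fun R _ => by rw [pow_add, ← Finset.prod_pow_eq_pow_sum],
      ← Finset.mul_sum, ← Finset.prod_one_add]
    refine mul_le_mul_of_nonneg_left ?_ (pow_nonneg hx n)
    calc (1 + x ^ (4 * T + 8)) ^ (n / (2 * (T + 1)))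
        ≤ (1 + x ^ (4 * T + 8)) ^ (admissibleCuts T p.1 p.2 n).card :=
          pow_le_pow_right₀ (by linarith [pow_nonneg hx (4 * T + 8)]) (div_le_card_admissibleCuts hp')
      _ = ∏ _c ∈ admissibleCuts T p.1 p.2 n, (1 + x ^ (4 * T + 8)) := (Finset.prod_const _).symm
      _ ≤ ∏ c ∈ admissibleCuts T p.1 p.2 n, (1 + x ^ cost n p c) :=
          Finset.prod_le_prod (fun c _ => by linarith [pow_nonneg hx (4 * T + 8)]) fun c hc => by
            have := pow_le_pow_of_le_one hx hx1 (hcost p hp c hc); linarith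
  calc (stripCount T n : ℝ) * x ^ n * (1 + x ^ (4 * T + 8)) ^ (n / (2 * (T + 1)))
      = ∑ _p ∈ stripPairs T n, x ^ n * (1 + x ^ (4 * T + 8)) ^ (n / (2 * (T + 1))) := by
        rw [stripCount, Finset.sum_const, nsmul_eq_mul, mul_assoc]
    _ ≤ _ := Finset.sum_le_sum key

/-- **The summed finite core from an abstract insertion**: if for every `n` the insertion `Ψ n` maps the pairs
(walk of `S_T`, subset of its admissible cuts) injectively to walks of `S_{T+1}` of length `n + total cost`, each cut
costing at most `4T+8`, then `c_n(S_T) xⁿ (1 + x^{4T+8})^{⌊n/(2(T+1))⌋} ≤ Σ_{m ≤ (4T+9)n} c_m(S_{T+1}) x^m` for all `n`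
and `0 < x ≤ 1`. [cite: MadrasSlade1993, §8.2, Theorem 8.2.1 (8.2.13) (the lane's column insertion, summed)] -/
theorem core_of_insertion
    (hcost : ∀ n p, p ∈ stripPairs T n → ∀ c ∈ admissibleCuts T p.1 p.2 n, cost n p c ≤ 4 * T + 8)
    (hmem : ∀ n p R, p ∈ stripPairs T n → R ⊆ admissibleCuts T p.1 p.2 n →
      Ψ n p R ∈ stripPairs (T + 1) (n + ∑ c ∈ R, cost n p c))
    (hinj : ∀ n, Set.InjOn (fun q : (Σ _ : Site 2 × (ℕ → Site 2), Finset ℤ) => Ψ n q.1 q.2) ↑(insDom T n)) :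
    ∀ n : ℕ, ∀ x : ℝ, 0 < x → x ≤ 1 →
      (stripCount T n : ℝ) * x ^ n * (1 + x ^ (4 * T + 8)) ^ (n / (2 * (T + 1))) ≤
        1 * ∑ m ∈ Finset.range ((4 * T + 9) * n + 1), (stripCount (T + 1) m : ℝ) * x ^ m := by
  intro n x hx hx1
  rw [one_mul]
  exact (le_sum_insDom (hcost n) hx.le hx1).trans (sum_insDom_le (hcost n) (hmem n) (hinj n) hx.le)

/-- **HEX-STRIP-STRICT from an insertion, with margin**: under (i)–(iii),
`log(1 + μ(S_{T+1})^{-(4T+8)}) / (2(T+1)) ≤ log μ(S_{T+1}) − log μ(S_T)` (a-idea-1's face `StripStrictMargin T`).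
[cite: MadrasSlade1993, §8.2, Theorem 8.2.1, eq. (8.2.13) (quantitative form, conditional on the insertion)]
[cite: BeatonBousquetMelouDeGierDuminilCopinGuttmann2014, Proposition 7 (y = 1)] -/
theorem log_stripConnectiveConstant_succ_sub_log_ge_of_insertion
    (hcost : ∀ n p, p ∈ stripPairs T n → ∀ c ∈ admissibleCuts T p.1 p.2 n, cost n p c ≤ 4 * T + 8)
    (hmem : ∀ n p R, p ∈ stripPairs T n → R ⊆ admissibleCuts T p.1 p.2 n →
      Ψ n p R ∈ stripPairs (T + 1) (n + ∑ c ∈ R, cost n p c))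
    (hinj : ∀ n, Set.InjOn (fun q : (Σ _ : Site 2 × (ℕ → Site 2), Finset ℤ) => Ψ n q.1 q.2) ↑(insDom T n)) :
    Real.log (1 + stripConnectiveConstant (T + 1) ^ (-(4 * (T : ℝ) + 8))) / (2 * ((T : ℝ) + 1)) ≤
      Real.log (stripConnectiveConstant (T + 1)) - Real.log (stripConnectiveConstant T) :=
  log_stripConnectiveConstant_succ_sub_log_ge_of_core T zero_le_one (core_of_insertion hcost hmem hinj)

/-- **HEX-STRIP-STRICT from an insertion**: under (i)–(iii), `μ(S_T) < μ(S_{T+1})`.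
[cite: BeatonBousquetMelouDeGierDuminilCopinGuttmann2014, Proposition 7 (y = 1)] [cite: MadrasSlade1993, §8.2, Theorem 8.2.1, eq. (8.2.13)] -/
theorem stripConnectiveConstant_lt_succ_of_insertion
    (hcost : ∀ n p, p ∈ stripPairs T n → ∀ c ∈ admissibleCuts T p.1 p.2 n, cost n p c ≤ 4 * T + 8)
    (hmem : ∀ n p R, p ∈ stripPairs T n → R ⊆ admissibleCuts T p.1 p.2 n →
      Ψ n p R ∈ stripPairs (T + 1) (n + ∑ c ∈ R, cost n p c))
    (hinj : ∀ n, Set.InjOn (fun q : (Σ _ : Site 2 × (ℕ → Site 2), Finset ℤ) => Ψ n q.1 q.2) ↑(insDom T n)) :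
    stripConnectiveConstant T < stripConnectiveConstant (T + 1) :=
  stripConnectiveConstant_lt_succ_of_core T zero_le_one (core_of_insertion hcost hmem hinj)

end Core

end Literature.Probability.RandomPlanarGeometry.SAW.HexBW
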